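import Summits.CriticalPhenomena.SAWScalingLimit.Theorems.SAWDevelopingMapHexConjectureBochnerIneqOfPositivity
import Summits.CriticalPhenomena.SAWScalingLimit.Theorems.SAWDevelopingMapHexConjectureTriangleChart
import Summits.CriticalPhenomena.SAWScalingLimit.Theorems.SAWDevelopingMapHexConjectureTriangleArchTransfer
import Summits.CriticalPhenomena.SAWScalingLimit.Theorems.SAWDevelopingMapHexConjectureTriDlLowerBound
import Mathlib.Analysis.Real.Pi.Bounds
import HarnessLib

/-!
# Crux `HexConjecture` (stmt-CriticalPhenomena-0808), line `root-locality-replaces-loewner` (lead c12):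
the Bochner tail inequalities and the averaged tail fraction imply lower regularity of `triDl`

Landing target:
`Summits/CriticalPhenomena/SAWScalingLimit/Theorems/SAWDevelopingMapHexConjectureRegOfBochnerAvgTail.lean`
(`--supports stmt-CriticalPhenomena-0808`; registered stub `stub_reg_of_bochner_avgTail`, s3's STUB 3).

Write `G(k) := RootLocality.halfPlaneArch k` (Krachun–Panagiotis's half-plane boundary two-point function),
`c := cos(3π/8)`, `Def(i) := 1/(2c) - Σ_{k=1}^{i} G(k)` (the boundary flux deficit) and `triDl` for
Glazman–Manolescu's triangle left-exit mass.  The registered statement is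
`HalfPlaneBochnerIneq → AverageTailFraction → TriDlLowerRegular`:
* hypothesis (Bochner family): `Σ_{1 ≤ k < M} G(k)·(cos((3π/8)(2k/M - 1)) - c) ≤ (1 + c)·Def(M)` for `M ≥ 1`;
* hypothesis (AvgTF): `Σ_{i ≤ T} triDl i ≤ C_A · Σ_{i ≤ T} Def(i)` for `T ≥ 1`;
* conclusion (REG): `Σ_{i ≤ T} triDl i ≤ C·(T+1)·triDl T` for `T ≥ 1`.
Proof (everything discrete):
(i) ONE STEP (`RegOfBochner.one_step`): in the Bochner inequality at `M = 18m` the weight is `≥ 0` on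
`[1, M)` and `≥ cos(π/3) - c = 1/2 - c` on `[m, 17m]`, so `(1/2 - c)(Def(m) - Def(17m)) ≤ (1+c)·Def(17m)`,
i.e. `Def(m) ≤ λ·Def(17m)` with `λ = (3/2)/(1/2 - c) < 17` because `c = sin(π/8) < π/8 < 7/17`
(`RegOfBochner.cos_three_pi_div_eight_lt`).
(ii) SUMMATION (`RegOfBochner.sum_le_of_one_step`, for any antitone `D` with `D(m) ≤ λ D(17m)`, `λ < 17`):
`S(n) := Σ_{i=1}^{n} D(i) ≤ λ Σ_{i ≤ n} D(17i) ≤ (λ/17)·S(17n) ≤ (λ/17)(S(n) + 16n·D(n))`, hence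
`S(n) ≤ (16λ/(17 - λ))·n·D(n)`.
(iii) `Def(T) ≤ (cos(π/8)/c)·triDl T` (`RegOfBochner.def_le_triDl`): the `α`-arches of the inscribed triangle
`T_0(T)` are floor arches of the half-strip `S_0(2T)` at the offsets `0 < |d| ≤ T`
(`stub_triA_le_sum_archMass_triChart`, `archMass_mono`, `archMass_halfStrip_offset`), the coded strip sums are
below their supremum `G` and `G` is even (`stub_codedArchSum_reflect`), so `triA T ≤ 2 Σ_{k ≤ T} G(k)`
(`RegOfBochner.triA_le_two_mul_sum`); conclude with the triangle identity `c·triA + 2cos(π/8)·triDl = 1`.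
(iv) ASSEMBLY: `Def ≥ 0` (`BochnerIneq.sum_halfPlaneArch_le`), so `C_A` may be replaced by `max C_A 0`;
`Σ_{i ≤ T} Def(i) = 1/(2c) + S(T) ≤ 1/(2c) + K·T·Def(T)`, `1/(2c) ≤ (T+1)·triDl T/(2cm)` by the harmonic
lower bound `triDl T ≥ m/(T+1)` (`stub_triDlLowerBound`), and (iii).
Sources: KrachunPanagiotis2026 (Definition 2.4, Lemma 2.2), GlazmanManolescu2019 (Lemma 4.1),
DuminilCopinSmirnov2012 (Lemma 2, §3); the Bochner/regularity bookkeeping is folklore.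
-/

noncomputable section

open scoped BigOperators Topology Classical
open Literature.Probability.LatticeModels (HexVertex hexGraph hexCenter Site)
open Literature.Probability.RandomPlanarGeometry
open Literature.Probability.RandomPlanarGeometry.SAW
open Literature.Probability.RandomPlanarGeometry.SAW.HV
open Summit.CriticalPhenomena.SAWScalingLimit.Theorems.ObservableToSLE.FloorRatio

namespace Summit.CriticalPhenomena.SAWScalingLimit.Theorems.HexConjecture.RootLocality

namespace RegOfBochner

/-- `cos(3π/8) < 7/17` (`cos(3π/8) = sin(π/8) < π/8` and `π < 3.15`). [folklore] -/
theorem cos_three_pi_div_eight_lt : Real.cos (3 * Real.pi / 8) < 7 / 17 := by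
  rw [show 3 * Real.pi / 8 = Real.pi / 2 - Real.pi / 8 by ring, Real.cos_pi_div_two_sub]
  have h1 : Real.sin (Real.pi / 8) < Real.pi / 8 := Real.sin_lt (by positivity)
  have h2 : Real.pi < 3.15 := Real.pi_lt_d2
  norm_num at h2
  linarith

/-! ### The weights of the Bochner inequality -/

/-- The Bochner weight is nonnegative on `[0, M]`: `cos((3π/8)(2k/M - 1)) ≥ cos(3π/8)` since
`|2k/M - 1| ≤ 1`. [folklore] -/
theorem weight_nonneg {M k : ℕ} (hM : 1 ≤ M) (hk : k ≤ M) :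
    Real.cos (3 * Real.pi / 8) ≤ Real.cos (3 * Real.pi / 8 * (2 * (k : ℝ) / M - 1)) := by
  have hM' : (0 : ℝ) < M := by exact_mod_cast hM
  have hkM : (k : ℝ) ≤ M := by exact_mod_cast hk
  have hs : |2 * (k : ℝ) / M - 1| ≤ 1 := by
    rw [abs_sub_le_iff]
    constructor
    · have : 2 * (k : ℝ) / M ≤ 2 := by rw [div_le_iff₀ hM']; linarith
      linarith
    · have : 0 ≤ 2 * (k : ℝ) / M := by positivity
      linarith
  have ht : |3 * Real.pi / 8 * (2 * (k : ℝ) / M - 1)| ≤ 3 * Real.pi / 8 := by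
    rw [abs_mul, abs_of_nonneg (by positivity : (0 : ℝ) ≤ 3 * Real.pi / 8)]
    calc 3 * Real.pi / 8 * |2 * (k : ℝ) / M - 1| ≤ 3 * Real.pi / 8 * 1 :=
          mul_le_mul_of_nonneg_left hs (by positivity)
      _ = 3 * Real.pi / 8 := mul_one _
  rw [← Real.cos_abs (3 * Real.pi / 8 * _)]
  exact Real.cos_le_cos_of_nonneg_of_le_pi (abs_nonneg _) (by linarith [Real.pi_pos]) ht

/-- The Bochner weight at scale `M = 18m` is at least `1/2 = cos(π/3)` on `[m, 17m]`, where
`|(3π/8)(2k/M - 1)| ≤ (3π/8)(8/9) = π/3`. [folklore] -/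
theorem weight_ge_half {m k : ℕ} (hm : 1 ≤ m) (hmk : m ≤ k) (hk : k ≤ 17 * m) :
    1 / 2 ≤ Real.cos (3 * Real.pi / 8 * (2 * (k : ℝ) / ((18 * m : ℕ) : ℝ) - 1)) := by
  have hm' : (0 : ℝ) < m := by exact_mod_cast hm
  have hk' : (k : ℝ) ≤ 17 * m := by exact_mod_cast hk
  have hmk' : (m : ℝ) ≤ k := by exact_mod_cast hmk
  have hs : |2 * (k : ℝ) / ((18 * m : ℕ) : ℝ) - 1| ≤ 8 / 9 := by
    push_cast
    rw [abs_sub_le_iff]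
    constructor
    · have : 2 * (k : ℝ) / (18 * m) ≤ 17 / 9 := by rw [div_le_iff₀ (by positivity)]; linarith
      linarith
    · have : 1 / 9 ≤ 2 * (k : ℝ) / (18 * m) := by rw [le_div_iff₀ (by positivity)]; linarith
      linarith
  have ht : |3 * Real.pi / 8 * (2 * (k : ℝ) / ((18 * m : ℕ) : ℝ) - 1)| ≤ Real.pi / 3 := by
    rw [abs_mul, abs_of_nonneg (by positivity : (0 : ℝ) ≤ 3 * Real.pi / 8)]
    calc 3 * Real.pi / 8 * |2 * (k : ℝ) / ((18 * m : ℕ) : ℝ) - 1| ≤ 3 * Real.pi / 8 * (8 / 9) :=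
          mul_le_mul_of_nonneg_left hs (by positivity)
      _ = Real.pi / 3 := by ring
  rw [← Real.cos_pi_div_three, ← Real.cos_abs (3 * Real.pi / 8 * _)]
  exact Real.cos_le_cos_of_nonneg_of_le_pi (abs_nonneg _) (by linarith [Real.pi_pos]) ht

/-! ### (i) One step of lower regularity of the flux deficit from the Bochner inequality -/

/-- **One step.**  If `G ≥ 0` satisfies the Bochner family of inequalities, then the flux deficit
`Def(m) = 1/(2cos(3π/8)) - Σ_{k ≤ m} G(k)` obeys `Def(m) ≤ λ·Def(17m)` with
`λ = (3/2)/(1/2 - cos(3π/8))`: apply the inequality at `M = 18m`, where the weight is `≥ 1/2 - cos(3π/8)`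
on `(m, 17m]` and `≥ 0` elsewhere. [folklore] -/
theorem one_step (G : ℕ → ℝ) (hG0 : ∀ k, 0 ≤ G k)
    (hB : ∀ M : ℕ, 1 ≤ M → ∑ k ∈ Finset.Ico 1 M, G k * (Real.cos (3 * Real.pi / 8 * (2 * (k : ℝ) / M - 1)) - Real.cos (3 * Real.pi / 8)) ≤ (1 + Real.cos (3 * Real.pi / 8)) * (1 / (2 * Real.cos (3 * Real.pi / 8)) - ∑ k ∈ Finset.Icc 1 M, G k))
    (m : ℕ) (hm : 1 ≤ m) :
    1 / (2 * Real.cos (3 * Real.pi / 8)) - ∑ k ∈ Finset.Icc 1 m, G k ≤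
      3 / 2 / (1 / 2 - Real.cos (3 * Real.pi / 8)) *
        (1 / (2 * Real.cos (3 * Real.pi / 8)) - ∑ k ∈ Finset.Icc 1 (17 * m), G k) := by
  have hw0 : ∀ k ∈ Finset.Ico 1 (18 * m), 0 ≤
      Real.cos (3 * Real.pi / 8 * (2 * (k : ℝ) / ((18 * m : ℕ) : ℝ) - 1)) - Real.cos (3 * Real.pi / 8) :=
    fun k hk => sub_nonneg.2 (weight_nonneg (by omega) (Finset.mem_Ico.1 hk).2.le)
  have hw1 : ∀ k ∈ Finset.Icc 1 (17 * m) \ Finset.Icc 1 m, 1 / 2 - Real.cos (3 * Real.pi / 8) ≤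
      Real.cos (3 * Real.pi / 8 * (2 * (k : ℝ) / ((18 * m : ℕ) : ℝ) - 1)) - Real.cos (3 * Real.pi / 8) := by
    intro k hk
    rw [Finset.mem_sdiff, Finset.mem_Icc, Finset.mem_Icc] at hk
    exact sub_le_sub_right (weight_ge_half hm (by omega) hk.1.2) _
  have h := hB (18 * m) (by omega)
  set c := Real.cos (3 * Real.pi / 8) with hc_def
  have hc7 : c < 7 / 17 := cos_three_pi_div_eight_lt
  have hc0 : 0 < c := cos_three_pi_div_eight_pos
  have hsub1 : Finset.Icc 1 m ⊆ Finset.Icc 1 (17 * m) := Finset.Icc_subset_Icc le_rfl (by omega)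
  have hsub2 : Finset.Icc 1 (17 * m) \ Finset.Icc 1 m ⊆ Finset.Ico 1 (18 * m) := by
    intro k hk
    rw [Finset.mem_sdiff, Finset.mem_Icc, Finset.mem_Icc] at hk
    rw [Finset.mem_Ico]
    omega
  have hsplit : ∑ k ∈ Finset.Icc 1 (17 * m), G k =
      ∑ k ∈ Finset.Icc 1 (17 * m) \ Finset.Icc 1 m, G k + ∑ k ∈ Finset.Icc 1 m, G k :=
    (Finset.sum_sdiff hsub1).symm
  have key : (1 / 2 - c) * ∑ k ∈ Finset.Icc 1 (17 * m) \ Finset.Icc 1 m, G k ≤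
      (1 + c) * (1 / (2 * c) - ∑ k ∈ Finset.Icc 1 (18 * m), G k) :=
    calc (1 / 2 - c) * ∑ k ∈ Finset.Icc 1 (17 * m) \ Finset.Icc 1 m, G k
          = ∑ k ∈ Finset.Icc 1 (17 * m) \ Finset.Icc 1 m, G k * (1 / 2 - c) := by
            rw [Finset.mul_sum]
            exact Finset.sum_congr rfl fun k _ => mul_comm _ _
      _ ≤ ∑ k ∈ Finset.Icc 1 (17 * m) \ Finset.Icc 1 m,
            G k * (Real.cos (3 * Real.pi / 8 * (2 * (k : ℝ) / ((18 * m : ℕ) : ℝ) - 1)) - c) :=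
            Finset.sum_le_sum fun k hk => mul_le_mul_of_nonneg_left (hw1 k hk) (hG0 k)
      _ ≤ ∑ k ∈ Finset.Ico 1 (18 * m),
            G k * (Real.cos (3 * Real.pi / 8 * (2 * (k : ℝ) / ((18 * m : ℕ) : ℝ) - 1)) - c) :=
            Finset.sum_le_sum_of_subset_of_nonneg hsub2 fun k hk _ => mul_nonneg (hG0 k) (hw0 k hk)
      _ ≤ _ := h
  have hmono : ∑ k ∈ Finset.Icc 1 (17 * m), G k ≤ ∑ k ∈ Finset.Icc 1 (18 * m), G k :=
    Finset.sum_le_sum_of_subset_of_nonneg (Finset.Icc_subset_Icc le_rfl (by omega)) fun k _ _ => hG0 k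
  have hmono' : (1 + c) * (1 / (2 * c) - ∑ k ∈ Finset.Icc 1 (18 * m), G k) ≤
      (1 + c) * (1 / (2 * c) - ∑ k ∈ Finset.Icc 1 (17 * m), G k) :=
    mul_le_mul_of_nonneg_left (by linarith) (by linarith)
  have h12 : 0 < 1 / 2 - c := by linarith
  have hP1 : ∑ k ∈ Finset.Icc 1 m, G k =
      ∑ k ∈ Finset.Icc 1 (17 * m), G k - ∑ k ∈ Finset.Icc 1 (17 * m) \ Finset.Icc 1 m, G k := by
    linarith
  rw [hP1, div_mul_eq_mul_div, le_div_iff₀ h12]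
  linarith

/-! ### (ii) Summing the one-step inequality -/

/-- **Summation of the one-step inequality.**  If `D` is non-increasing and `D(m) ≤ λ·D(17m)` for all
`m ≥ 1` with `0 ≤ λ < 17`, then `Σ_{i=1}^{n} D(i) ≤ (16λ/(17 - λ))·n·D(n)`:
`S(n) ≤ λ Σ_{i ≤ n} D(17i) ≤ (λ/17) S(17n)` (blocks of length `17`) and `S(17n) ≤ S(n) + 16n·D(n)`.
[folklore] -/
theorem sum_le_of_one_step (D : ℕ → ℝ) (hanti : ∀ ⦃i j : ℕ⦄, i ≤ j → D j ≤ D i) (l : ℝ)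
    (hl0 : 0 ≤ l) (hl : l < 17) (hstep : ∀ m : ℕ, 1 ≤ m → D m ≤ l * D (17 * m)) (n : ℕ) :
    ∑ i ∈ Finset.range n, D (i + 1) ≤ 16 * l / (17 - l) * n * D n := by
  -- (A) blocks: `17 Σ_{i ≤ n} D(17 i) ≤ S(17 n)`
  have hA : ∀ n : ℕ, 17 * ∑ i ∈ Finset.range n, D (17 * (i + 1)) ≤
      ∑ i ∈ Finset.range (17 * n), D (i + 1) := by
    intro n
    induction n with
    | zero => simp
    | succ n ih =>
      rw [Finset.sum_range_succ, mul_add, show 17 * (n + 1) = 17 * n + 17 by ring,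
        Finset.sum_range_add]
      have h17 : 17 * D (17 * n + 17) ≤ ∑ x ∈ Finset.range 17, D (17 * n + x + 1) :=
        calc 17 * D (17 * n + 17) = ∑ x ∈ Finset.range 17, D (17 * n + 17) := by
              rw [Finset.sum_const, Finset.card_range, nsmul_eq_mul]; norm_num
          _ ≤ ∑ x ∈ Finset.range 17, D (17 * n + x + 1) :=
              Finset.sum_le_sum fun x hx => hanti (by rw [Finset.mem_range] at hx; omega)
      linarith
  -- (B) `S(17 n) ≤ S(n) + 16 n D(n)`
  have hB : ∑ i ∈ Finset.range (17 * n), D (i + 1) ≤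
      ∑ i ∈ Finset.range n, D (i + 1) + 16 * n * D n := by
    rw [show 17 * n = n + 16 * n by ring, Finset.sum_range_add]
    have h1 : ∑ x ∈ Finset.range (16 * n), D (n + x + 1) ≤ ∑ x ∈ Finset.range (16 * n), D n :=
      Finset.sum_le_sum fun x _ => hanti (by omega)
    have e : ∑ x ∈ Finset.range (16 * n), D n = 16 * n * D n := by
      rw [Finset.sum_const, Finset.card_range, nsmul_eq_mul]; push_cast; ring
    linarith
  -- (C) the one-step inequality termwise
  have hC : ∑ i ∈ Finset.range n, D (i + 1) ≤ l * ∑ i ∈ Finset.range n, D (17 * (i + 1)) := by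
    rw [Finset.mul_sum]
    exact Finset.sum_le_sum fun i _ => hstep (i + 1) (by omega)
  have h1 := mul_le_mul_of_nonneg_left (hA n) hl0
  have h2 := mul_le_mul_of_nonneg_left hB hl0
  have h17l : 0 < 17 - l := by linarith
  rw [div_mul_eq_mul_div, div_mul_eq_mul_div, le_div_iff₀ h17l]
  linarith

/-! ### (iii) The flux deficit is at most a multiple of the triangle tail -/

/-- **The triangle's boundary arches are half-plane arches at offsets `0 < |d| ≤ T`**:
`A^Δ(T) ≤ 2·Σ_{k=1}^{T} G(k)`.  The `α`-arches of the inscribed triangle `T_0(T)` are floor arches of the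
half-strip `S_0(2T)` (`stub_triA_le_sum_archMass_triChart`, `archMass_mono`), whose mass at offset `d` is
the coded strip sum (`archMass_halfStrip_offset`), itself below its supremum `G(d)`; and `G` is even.
[cite: KrachunPanagiotis2026, Lemma 2.2; GlazmanManolescu2019, §4.1 (A^Δ)] -/
theorem triA_le_two_mul_sum (T : ℕ) :
    triA T ≤ 2 * ∑ k ∈ Finset.Icc 1 T, halfPlaneArch (k : ℤ) := by
  classical
  -- the coded sums `A d N` of the trapezoid `S_{N+1,N+1}`
  obtain ⟨A, hA⟩ : ∃ A : ℤ → ℕ → ℝ, ∀ d N, A d N = ∑ P ∈ (midWalks (stripV (N + 1) (N + 1))).filter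
      (fun P => finalDart P = ((d, 0, false), (d, -1, true)) ∨
        finalDart P = ((d, -1, true), (d, 0, false))), hexCriticalFugacity ^ mwLen P :=
    ⟨_, fun _ _ => rfl⟩
  have hGA : ∀ d, halfPlaneArch d = ⨆ N, A d N := fun d => by simp only [hA]; rfl
  have hA0 : ∀ d N, 0 ≤ A d N := fun d N => by rw [hA]; exact codedArchSum_nonneg d N
  have hAmono : ∀ d, Monotone (A d) := fun d N R h => by rw [hA, hA]; exact hvArchSum_mono d h
  have hAtot : ∀ N : ℕ, ∑ d ∈ (Finset.Icc (-((N : ℤ) + 1)) ((N : ℤ) + 1)).erase 0, A d N ≤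
      (Real.cos (3 * Real.pi / 8))⁻¹ := fun N => by simp only [hA]; exact archTotal_le N
  -- boundedness of the coded sums and `A d N ≤ G d` for `d ≠ 0`
  have hbdd : ∀ d : ℤ, d ≠ 0 → BddAbove (Set.range (A d)) := fun d hd =>
    ⟨(Real.cos (3 * Real.pi / 8))⁻¹, by
      rintro _ ⟨N, rfl⟩
      have hdR : |d| ≤ ((N + d.natAbs : ℕ) : ℤ) + 1 := by
        rw [Int.abs_eq_natAbs]; push_cast; omega
      calc A d N ≤ A d (N + d.natAbs) := hAmono d (Nat.le_add_right _ _)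
        _ ≤ ∑ d' ∈ (Finset.Icc (-(((N + d.natAbs : ℕ) : ℤ) + 1)) (((N + d.natAbs : ℕ) : ℤ) + 1)).erase 0,
              A d' (N + d.natAbs) :=
            Finset.single_le_sum (f := fun d' => A d' (N + d.natAbs)) (fun d' _ => hA0 d' _)
              (mem_offsetWindow_iff.2 ⟨hd, hdR⟩)
        _ ≤ _ := hAtot _⟩
  have hAG : ∀ d : ℤ, d ≠ 0 → ∀ N, A d N ≤ halfPlaneArch d := fun d hd N => by
    rw [hGA]; exact le_ciSup (hbdd d hd) N
  -- evenness of `G`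
  have hGneg : ∀ d : ℤ, halfPlaneArch (-d) = halfPlaneArch d := fun d => by
    rw [hGA, hGA]
    exact iSup_congr fun N => by rw [hA, hA]; exact stub_codedArchSum_reflect N d
  -- the triangle's arches inside the half-strip `S_0(2T)`
  set x : Site 2 := 0 with hx
  set N : ℕ := 2 * T with hN
  set HSN := (stripV (N + 1) (N + 1)).map (hvIso.trans (shift (-(x 0)) (-(x 1)))).symm.toEquiv.toEmbedding
    with hHSN
  set DL := (Finset.Icc (-(T : ℤ)) (T : ℤ)).erase 0 with hDL
  set s : Sym2 HexVertex := s((x - Pi.single 1 1, 1), (x, 0)) with hs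
  set Z : Finset HexVertex → ℤ → ℝ := fun Λ' d => ∑ γ : HexMidEdgeSAW Λ' s
      s((x + Pi.single 0 d - Pi.single 1 1, 1), (x + Pi.single 0 d, 0)), hexCriticalFugacity ^ γ.length
    with hZ
  have h2 : triA T ≤ ∑ d ∈ DL, Z HSN d :=
    (stub_triA_le_sum_archMass_triChart x T).trans
      (Finset.sum_le_sum fun d _ => archMass_mono (triChart_subset_halfStrip x (le_refl (2 * T))) s _)
  have e : ∀ d ∈ DL, Z HSN d = A d N := by
    intro d hd
    rw [hA]
    refine archMass_halfStrip_offset x N d ?_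
    rw [hDL, Finset.mem_erase, Finset.mem_Icc] at hd
    rw [abs_le, hN]
    push_cast
    constructor <;> linarith
  rw [Finset.sum_congr rfl e] at h2
  -- `A d N ≤ G d` on the window, then split the window into `±k`, `1 ≤ k ≤ T`
  have h3 : ∑ d ∈ DL, A d N ≤ ∑ d ∈ DL, halfPlaneArch d :=
    Finset.sum_le_sum fun d hd => hAG d (Finset.mem_erase.1 hd).1 N
  have h4 : ∑ d ∈ DL, halfPlaneArch d ≤ 2 * ∑ k ∈ Finset.Icc 1 T, halfPlaneArch (k : ℤ) := by
    set S := Finset.Icc 1 T with hS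
    have hpos : ∀ k ∈ S, 0 < k := fun k hk => by rw [hS, Finset.mem_Icc] at hk; omega
    have hinj₁ : Set.InjOn (fun k : ℕ => (k : ℤ)) S := fun a _ b _ h => by simpa using h
    have hinj₂ : Set.InjOn (fun k : ℕ => -(k : ℤ)) S := fun a _ b _ h => by simpa using h
    have hdisj : Disjoint (S.image fun k : ℕ => (k : ℤ)) (S.image fun k : ℕ => -(k : ℤ)) := by
      rw [Finset.disjoint_left]
      intro y h₁ h₂
      obtain ⟨k, hk, rfl⟩ := Finset.mem_image.1 h₁
      obtain ⟨k', hk', h⟩ := Finset.mem_image.1 h₂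
      have := hpos k hk
      omega
    have hsub : DL ⊆ (S.image fun k : ℕ => (k : ℤ)) ∪ (S.image fun k : ℕ => -(k : ℤ)) := by
      intro d hd
      rw [hDL, Finset.mem_erase, Finset.mem_Icc] at hd
      rw [Finset.mem_union, Finset.mem_image, Finset.mem_image]
      rcases lt_or_gt_of_ne hd.1 with h | h
      · exact Or.inr ⟨d.natAbs, by rw [hS, Finset.mem_Icc]; omega, by omega⟩
      · exact Or.inl ⟨d.natAbs, by rw [hS, Finset.mem_Icc]; omega, by omega⟩
    calc ∑ d ∈ DL, halfPlaneArch d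
        ≤ ∑ d ∈ (S.image fun k : ℕ => (k : ℤ)) ∪ (S.image fun k : ℕ => -(k : ℤ)), halfPlaneArch d :=
          Finset.sum_le_sum_of_subset_of_nonneg hsub fun d _ _ => BochnerIneq.halfPlaneArch_nonneg d
      _ = ∑ k ∈ S, halfPlaneArch (k : ℤ) + ∑ k ∈ S, halfPlaneArch (-(k : ℤ)) := by
          rw [Finset.sum_union hdisj, Finset.sum_image hinj₁, Finset.sum_image hinj₂]
      _ = 2 * ∑ k ∈ S, halfPlaneArch (k : ℤ) := by
          have e2 : ∑ k ∈ S, halfPlaneArch (-(k : ℤ)) = ∑ k ∈ S, halfPlaneArch (k : ℤ) :=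
            Finset.sum_congr rfl fun k _ => hGneg (k : ℤ)
          rw [e2, two_mul]
  linarith

/-- **The flux deficit is at most `(cos(π/8)/cos(3π/8))·triDl`**: from `A^Δ(T) ≤ 2 Σ_{k ≤ T} G(k)`
(`triA_le_two_mul_sum`) and the triangle identity `cos(3π/8)·A^Δ + 2cos(π/8)·triDl = 1`
(Glazman–Manolescu, Lemma 4.1), `1/(2cos(3π/8)) - Σ_{k ≤ T} G(k) ≤ 1/(2cos(3π/8)) - A^Δ(T)/2
= (cos(π/8)/cos(3π/8))·triDl T`. [cite: GlazmanManolescu2019, Lemma 4.1; KrachunPanagiotis2026, Lemma 2.2] -/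
theorem def_le_triDl (T : ℕ) :
    1 / (2 * Real.cos (3 * Real.pi / 8)) - ∑ k ∈ Finset.Icc 1 T, halfPlaneArch (k : ℤ) ≤
      Real.cos (Real.pi / 8) / Real.cos (3 * Real.pi / 8) * triDl T := by
  have h := triA_le_two_mul_sum T
  have hid := tri_identity' T
  have hc := cos_three_pi_div_eight_pos
  have h1 : Real.cos (Real.pi / 8) / Real.cos (3 * Real.pi / 8) * triDl T =
      1 / (2 * Real.cos (3 * Real.pi / 8)) - triA T / 2 := by
    rw [div_mul_eq_mul_div, show Real.cos (Real.pi / 8) * triDl T =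
      (1 - Real.cos (3 * Real.pi / 8) * triA T) / 2 by linarith]
    field_simp
  rw [h1]
  linarith

end RegOfBochner

/-- **Registered stub `stub_reg_of_bochner_avgTail`** (crux item stmt-CriticalPhenomena-0808, line
`root-locality-replaces-loewner`, lead c12; s3's STUB 3): the Bochner family of tail inequalities for the
half-plane boundary two-point function `G = halfPlaneArch` together with the averaged tail fraction
(`Σ_{i ≤ T} triDl i ≤ C_A Σ_{i ≤ T} Def(i)`) implies lower regularity of the triangle tail,
`Σ_{i ≤ T} triDl i ≤ C (T+1) triDl T`.  Proof: one-step lower regularity of the flux deficit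
`Def(m) ≤ λ Def(17m)`, `λ = (3/2)/(1/2 - cos(3π/8)) < 17` (`RegOfBochner.one_step`), summed in blocks
(`RegOfBochner.sum_le_of_one_step`), the comparison `Def(T) ≤ (cos(π/8)/cos(3π/8))·triDl T`
(`RegOfBochner.def_le_triDl`) and the harmonic lower bound `triDl T ≥ m/(T+1)` (`stub_triDlLowerBound`).
[cite: KrachunPanagiotis2026, Definition 2.4 and Lemma 2.2; GlazmanManolescu2019, Lemma 4.1] -/
theorem stub_reg_of_bochner_avgTail : (∀ M : ℕ, 1 ≤ M → ∑ k ∈ Finset.Ico 1 M, Summit.CriticalPhenomena.SAWScalingLimit.Theorems.HexConjecture.RootLocality.halfPlaneArch ((k : ℕ) : ℤ) * (Real.cos (3 * Real.pi / 8 * (2 * (k : ℝ) / M - 1)) - Real.cos (3 * Real.pi / 8)) ≤ (1 + Real.cos (3 * Real.pi / 8)) * (1 / (2 * Real.cos (3 * Real.pi / 8)) - ∑ k ∈ Finset.Icc 1 M, Summit.CriticalPhenomena.SAWScalingLimit.Theorems.HexConjecture.RootLocality.halfPlaneArch ((k : ℕ) : ℤ))) → (∃ C : ℝ, ∀ T :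 ℕ, 1 ≤ T → ∑ i ∈ Finset.range (T + 1), Literature.Probability.RandomPlanarGeometry.SAW.HV.triDl i ≤ C * ∑ i ∈ Finset.range (T + 1), (1 / (2 * Real.cos (3 * Real.pi / 8)) - ∑ k ∈ Finset.Icc 1 i, Summit.CriticalPhenomena.SAWScalingLimit.Theorems.HexConjecture.RootLocality.halfPlaneArch ((k : ℕ) : ℤ))) → (∃ C : ℝ, ∀ T : ℕ, 1 ≤ T → ∑ i ∈ Finset.range (T + 1), Literature.Probability.RandomPlanarGeometry.SAW.HV.triDl i ≤ C * ((T : ℝ) + 1) * Literature.Probability.RandomPlanarGeometry.SAW.HV.triDl T) := by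
  intro hB hT
  obtain ⟨CA, hCA⟩ := hT
  obtain ⟨m, hm0, hm⟩ := stub_triDlLowerBound
  have hG0 : ∀ k : ℕ, 0 ≤ halfPlaneArch (k : ℤ) := fun k => BochnerIneq.halfPlaneArch_nonneg _
  -- the one-step inequality for the flux deficit
  have hstep : ∀ n : ℕ, 1 ≤ n →
      1 / (2 * Real.cos (3 * Real.pi / 8)) - ∑ k ∈ Finset.Icc 1 n, halfPlaneArch (k : ℤ) ≤
        3 / 2 / (1 / 2 - Real.cos (3 * Real.pi / 8)) *
          (1 / (2 * Real.cos (3 * Real.pi / 8)) - ∑ k ∈ Finset.Icc 1 (17 * n), halfPlaneArch (k : ℤ)) :=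
    fun n hn => RegOfBochner.one_step (fun k => halfPlaneArch (k : ℤ)) hG0 hB n hn
  set c := Real.cos (3 * Real.pi / 8) with hc_def
  have hc : 0 < c := cos_three_pi_div_eight_pos
  have hc7 : c < 7 / 17 := RegOfBochner.cos_three_pi_div_eight_lt
  set l : ℝ := 3 / 2 / (1 / 2 - c) with hl_def
  have hl0 : 0 ≤ l := div_nonneg (by norm_num) (by linarith)
  have hl17 : l < 17 := by
    rw [hl_def, div_lt_iff₀ (by linarith)]
    linarith
  set K : ℝ := 16 * l / (17 - l) with hK_def
  have hK0 : 0 ≤ K := div_nonneg (by positivity) (by linarith)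
  set κ : ℝ := Real.cos (Real.pi / 8) / c with hκ_def
  have hκ0 : 0 ≤ κ := div_nonneg cos_pi_div_eight_pos.le hc.le
  set D : ℕ → ℝ := fun i => 1 / (2 * c) - ∑ k ∈ Finset.Icc 1 i, halfPlaneArch (k : ℤ) with hD_def
  have hDanti : ∀ ⦃i j : ℕ⦄, i ≤ j → D j ≤ D i := fun i j hij => by
    have := Finset.sum_le_sum_of_subset_of_nonneg (f := fun k : ℕ => halfPlaneArch (k : ℤ))
      (Finset.Icc_subset_Icc (le_refl 1) hij) (fun k _ _ => hG0 k)
    simp only [hD_def]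
    linarith
  have hDnn : ∀ i, 0 ≤ D i := fun i => by
    have := BochnerIneq.sum_halfPlaneArch_le (Finset.Icc 1 i) (by simp)
    simp only [hD_def]
    linarith
  have hstep' : ∀ n : ℕ, 1 ≤ n → D n ≤ l * D (17 * n) := fun n hn => hstep n hn
  refine ⟨max CA 0 * (1 / (2 * c * m) + K * κ), fun T hT1 => ?_⟩
  have hS : ∑ i ∈ Finset.range T, D (i + 1) ≤ K * T * D T :=
    RegOfBochner.sum_le_of_one_step D hDanti l hl0 hl17 hstep' T
  have hiii : D T ≤ κ * triDl T := RegOfBochner.def_le_triDl T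
  have hm' : 1 / (2 * c) ≤ 1 / (2 * c * m) * ((T : ℝ) + 1) * triDl T := by
    have h := hm T
    rw [div_le_iff₀ (by positivity)] at h
    calc 1 / (2 * c) = 1 / (2 * c * m) * m := by field_simp
      _ ≤ 1 / (2 * c * m) * (triDl T * ((T : ℝ) + 1)) := mul_le_mul_of_nonneg_left h (by positivity)
      _ = _ := by ring
  have h1 : K * T * D T ≤ K * κ * ((T : ℝ) + 1) * triDl T :=
    calc K * T * D T ≤ K * T * (κ * triDl T) := mul_le_mul_of_nonneg_left hiii (by positivity)
      _ ≤ K * ((T : ℝ) + 1) * (κ * triDl T) :=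
          mul_le_mul_of_nonneg_right (mul_le_mul_of_nonneg_left (by linarith) hK0)
            (mul_nonneg hκ0 (triDl_nonneg T))
      _ = _ := by ring
  have hsum : ∑ i ∈ Finset.range (T + 1), D i ≤ (1 / (2 * c * m) + K * κ) * ((T : ℝ) + 1) * triDl T := by
    rw [Finset.sum_range_succ']
    have hD0 : D 0 = 1 / (2 * c) := by simp [hD_def]
    rw [hD0]
    linarith
  calc ∑ i ∈ Finset.range (T + 1), triDl i ≤ CA * ∑ i ∈ Finset.range (T + 1), D i := hCA T hT1
    _ ≤ max CA 0 * ∑ i ∈ Finset.range (T + 1), D i :=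
        mul_le_mul_of_nonneg_right (le_max_left _ _) (Finset.sum_nonneg fun i _ => hDnn i)
    _ ≤ max CA 0 * ((1 / (2 * c * m) + K * κ) * ((T : ℝ) + 1) * triDl T) :=
        mul_le_mul_of_nonneg_left hsum (le_max_right _ _)
    _ = max CA 0 * (1 / (2 * c * m) + K * κ) * ((T : ℝ) + 1) * triDl T := by ring

end Summit.CriticalPhenomena.SAWScalingLimit.Theorems.HexConjecture.RootLocality

end
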